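import Mathlib.Data.Finsupp.Weight
import Mathlib.Data.Finsupp.Order
import Mathlib.Algebra.Group.Submonoid.Basic
import Mathlib.Data.Fin.VecNotation
import HarnessLib

/-!
# Crux `FrobeniusLadder.FRationalResolution` (stmt-ResolutionOfSingularities-15317), line `redirect`,
# stub `stub_diagonalizableQuotientResolution` — HILBERT BASES OF WEIGHT KERNELS BY A FINITE BOX CHECK
# (the slot `AddSubmonoid.closure G = P` of the fixed-point consumers, item (β-cert) of MEMO-15317-leafhand2-g25 §3)

Every consumer of the naive two-step pipeline (`…MonoidAlgebraModel`, `…FieldUniformCertificate`, `…ConeCertificateResolution`)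
takes the weight kernel `P = {m ∈ ℕⁿ : Σ mᵢ • aᵢ = 0}` of the fixed point together with a finite `G ∌ 0` and a proof of
`AddSubmonoid.closure G = P` (a Hilbert basis). For a class `1/r(a₁,…,aₙ)` this is an infinite statement; this file reduces it to
a FINITE one, decidable on concrete data:

* `sub_mem_of_weight` — weight kernels are closed under differences `m − g` (`g ≤ m`);
* `exists_mem_le` — the reduction step: a non-zero `m ∈ P` dominates a non-zero member of `G`, provided `G` contains the `r • eᵢ` and
  dominates every non-zero kernel element of the box `[0, r)ⁿ`;
* ★ `closure_eq_of_box` — for ANY submonoid `P ⊆ ℕⁿ` closed under dominated differences: `G ⊆ P`, `r • eᵢ ∈ G` and the box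
  condition give `closure G = P` (induction on the degree);
* ★★ `closure_eq_weightKernel_of_box` — the weight-kernel form;
* ★★ `box_of_fin` — the box condition from a statement quantified over `Fin n → Fin r` (the form `decide` evaluates for a concrete
  class), and ★★★ `closure_eq_weightKernel_of_fin` — both combined: the Hilbert-basis slot from two finite checks.

Honest label: generic combinatorial helper toward ONE leaf stub (no stub, crux or summit closed). No definitions, no named facts,
no sorry. [folklore; cite: CoxLittleSchenck2011, §1.1, §1.3]
-/

-- single-problem summit: the doubled namespace component is forced
set_option linter.dupNamespace false

namespace Summit.ResolutionOfSingularities.ResolutionOfSingularities.Theorems.FRationalResolution.WeightKernelBasis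

variable {n : ℕ}

/-! ## §1 The reduction step and the induction -/

/-- **Weight kernels are closed under dominated differences**: if `Σ mᵢ • aᵢ = 0 = Σ gᵢ • aᵢ` and `g ≤ m` then `Σ (m − g)ᵢ • aᵢ = 0`
(in a group `A`). [folklore] -/
theorem sub_mem_of_weight {A : Type} [AddCommGroup A] (a : Fin n → A) (m g : Fin n →₀ ℕ)
    (hm : Finsupp.weight a m = 0) (hg : Finsupp.weight a g = 0) (hgm : g ≤ m) : Finsupp.weight a (m - g) = 0 := by
  have h := map_add (Finsupp.weight a) (m - g) g
  rw [tsub_add_cancel_of_le hgm, hm, hg, add_zero] at h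
  exact h.symm

/-- **The reduction step.** If `G` contains every `r • eᵢ` (`r > 0`) and dominates every non-zero `m ∈ P` inside the box `[0, r)ⁿ`,
then every non-zero `m ∈ P` dominates some non-zero `g ∈ G`. [folklore] -/
theorem exists_mem_le (P : AddSubmonoid (Fin n →₀ ℕ)) (G : Set (Fin n →₀ ℕ)) (r : ℕ) (hr0 : 0 < r)
    (hr : ∀ i, Finsupp.single i r ∈ G)
    (hbox : ∀ m ∈ P, m ≠ 0 → (∀ i, m i < r) → ∃ g ∈ G, g ≠ 0 ∧ g ≤ m)
    (m : Fin n →₀ ℕ) (hm : m ∈ P) (hm0 : m ≠ 0) : ∃ g ∈ G, g ≠ 0 ∧ g ≤ m := by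
  by_cases h : ∃ i, r ≤ m i
  · obtain ⟨i, hi⟩ := h
    exact ⟨Finsupp.single i r, hr i, Finsupp.single_ne_zero.2 hr0.ne', Finsupp.single_le_iff.2 hi⟩
  · push Not at h
    exact hbox m hm hm0 h

/-- ★ **Generation by a finite box check.** `P ⊆ ℕⁿ` a submonoid closed under dominated differences (`m, g ∈ P`, `g ≤ m` ⇒
`m − g ∈ P`), `G ⊆ P` containing every `r • eᵢ` (`r > 0`) and dominating every non-zero element of `P` in the box `[0, r)ⁿ`. Then
`AddSubmonoid.closure G = P`. (Induction on the degree `Σ mᵢ`: subtract a dominated member of `G`.) [folklore; cite: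
CoxLittleSchenck2011, §1.3] -/
theorem closure_eq_of_box (P : AddSubmonoid (Fin n →₀ ℕ)) (G : Set (Fin n →₀ ℕ)) (hGP : G ⊆ P)
    (hsub : ∀ m ∈ P, ∀ g ∈ P, g ≤ m → m - g ∈ P) (r : ℕ) (hr0 : 0 < r)
    (hr : ∀ i, Finsupp.single i r ∈ G)
    (hbox : ∀ m ∈ P, m ≠ 0 → (∀ i, m i < r) → ∃ g ∈ G, g ≠ 0 ∧ g ≤ m) :
    AddSubmonoid.closure G = P := by
  refine le_antisymm (AddSubmonoid.closure_le.2 hGP) fun m hm => ?_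
  -- induction on the degree
  suffices key : ∀ d : ℕ, ∀ m ∈ P, m.degree ≤ d → m ∈ AddSubmonoid.closure G from key _ m hm le_rfl
  intro d
  induction d with
  | zero =>
    intro m _ hd
    have hm0 : m = 0 := (Finsupp.degree_eq_zero_iff m).1 (Nat.le_zero.1 hd)
    rw [hm0]
    exact zero_mem _
  | succ d ih =>
    intro m hm hd
    by_cases hm0 : m = 0
    · rw [hm0]
      exact zero_mem _
    obtain ⟨g, hgG, hg0, hgm⟩ := exists_mem_le P G r hr0 hr hbox m hm hm0
    have hsplit : m - g + g = m := tsub_add_cancel_of_le hgm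
    have hdeg : (m - g).degree + g.degree = m.degree := by rw [← map_add, hsplit]
    have hgdeg : g.degree ≠ 0 := fun h => hg0 ((Finsupp.degree_eq_zero_iff g).1 h)
    have hle : (m - g).degree ≤ d := by omega
    have hmem : m - g ∈ AddSubmonoid.closure G := ih (m - g) (hsub m hm g (hGP hgG) hgm) hle
    rw [← hsplit]
    exact add_mem hmem (AddSubmonoid.subset_closure hgG)

/-- ★★ **Hilbert basis of a weight kernel by a finite box check.** `P = {m : Σ mᵢ • aᵢ = 0}` (`A` a group), `G` a set of kernel
elements containing every `r • eᵢ` (`r > 0`) and dominating every non-zero kernel element of the box `[0, r)ⁿ`: then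
`AddSubmonoid.closure G = P`. [folklore; cite: CoxLittleSchenck2011, §1.3] -/
theorem closure_eq_weightKernel_of_box {A : Type} [AddCommGroup A] (a : Fin n → A) (P : AddSubmonoid (Fin n →₀ ℕ))
    (hP : ∀ m, m ∈ P ↔ Finsupp.weight a m = 0) (G : Set (Fin n →₀ ℕ)) (hG : ∀ g ∈ G, Finsupp.weight a g = 0)
    (r : ℕ) (hr0 : 0 < r) (hr : ∀ i, Finsupp.single i r ∈ G)
    (hbox : ∀ m : Fin n →₀ ℕ, Finsupp.weight a m = 0 → m ≠ 0 → (∀ i, m i < r) → ∃ g ∈ G, g ≠ 0 ∧ g ≤ m) :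
    AddSubmonoid.closure G = P :=
  closure_eq_of_box P G (fun g hg => (hP g).2 (hG g hg))
    (fun m hm g hg hgm => (hP _).2 (sub_mem_of_weight a m g ((hP m).1 hm) ((hP g).1 hg) hgm)) r hr0 hr
    fun m hm hm0 hlt => hbox m ((hP m).1 hm) hm0 hlt

/-! ## §2 The finite form of the box condition -/

/-- `Σ mᵢ • aᵢ` written as a `Fintype` sum. [folklore] -/
theorem weight_eq_sum {A : Type} [AddCommMonoid A] (a : Fin n → A) (m : Fin n →₀ ℕ) :
    Finsupp.weight a m = ∑ i, m i • a i := by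
  rw [Finsupp.weight_apply, Finsupp.sum_fintype]
  intro i
  exact zero_smul ℕ (a i)

/-- ★★ **The box condition from its finite form.** If for every `f : Fin n → Fin r` with `Σ fᵢ • aᵢ = 0` and some `fᵢ ≠ 0` the set
`G` has a non-zero member `g` with `gᵢ ≤ fᵢ` for all `i`, then `G` dominates every non-zero kernel element of the box `[0, r)ⁿ`.
(The hypothesis is what `decide` evaluates on a concrete class.) [folklore] -/
theorem box_of_fin {A : Type} [AddCommMonoid A] (a : Fin n → A) (r : ℕ) (G : Set (Fin n →₀ ℕ))
    (h : ∀ f : Fin n → Fin r, (∑ i, ((f i : ℕ) • a i)) = 0 → (∃ i, (f i : ℕ) ≠ 0) →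
      ∃ g ∈ G, g ≠ 0 ∧ ∀ i, g i ≤ (f i : ℕ)) :
    ∀ m : Fin n →₀ ℕ, Finsupp.weight a m = 0 → m ≠ 0 → (∀ i, m i < r) → ∃ g ∈ G, g ≠ 0 ∧ g ≤ m := by
  intro m hm hm0 hlt
  have hex : ∃ i, ((⟨m i, hlt i⟩ : Fin r) : ℕ) ≠ 0 := by
    by_contra hne
    push Not at hne
    exact hm0 (Finsupp.ext fun i => hne i)
  have hsum : (∑ i, (((⟨m i, hlt i⟩ : Fin r) : ℕ) • a i)) = 0 := by
    rw [← hm, weight_eq_sum]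
  obtain ⟨g, hgG, hg0, hle⟩ := h (fun i => ⟨m i, hlt i⟩) hsum hex
  exact ⟨g, hgG, hg0, Finsupp.le_def.2 hle⟩

/-- ★★★ **The Hilbert-basis slot from two finite checks.** `P` the weight kernel of `a : Fin n → A`, `G ⊆ ℕⁿ` with (i) every member
in the kernel, (ii) every `r • eᵢ ∈ G` (`r > 0`), (iii) the finite box condition of `box_of_fin`: then `AddSubmonoid.closure G = P`.
[folklore; cite: CoxLittleSchenck2011, §1.3] -/
theorem closure_eq_weightKernel_of_fin {A : Type} [AddCommGroup A] (a : Fin n → A) (P : AddSubmonoid (Fin n →₀ ℕ))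
    (hP : ∀ m, m ∈ P ↔ Finsupp.weight a m = 0) (G : Set (Fin n →₀ ℕ)) (hG : ∀ g ∈ G, Finsupp.weight a g = 0)
    (r : ℕ) (hr0 : 0 < r) (hr : ∀ i, Finsupp.single i r ∈ G)
    (h : ∀ f : Fin n → Fin r, (∑ i, ((f i : ℕ) • a i)) = 0 → (∃ i, (f i : ℕ) ≠ 0) →
      ∃ g ∈ G, g ≠ 0 ∧ ∀ i, g i ≤ (f i : ℕ)) :
    AddSubmonoid.closure G = P :=
  closure_eq_weightKernel_of_box a P hP G hG r hr0 hr (box_of_fin a r G h)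

end Summit.ResolutionOfSingularities.ResolutionOfSingularities.Theorems.FRationalResolution.WeightKernelBasis
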